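import Mathlib
import Summits.ValiantsHypothesis.ValiantsHypothesis.Theorems.DivisionGapPerMultiplesHardStubTypedDecompositionFifth
import Summits.ValiantsHypothesis.ValiantsHypothesis.Theorems.DivisionGapPerMultiplesHardStubSpreadRigidity
import Summits.ValiantsHypothesis.ValiantsHypothesis.Theorems.DivisionGapPerMultiplesHardStubSpreadRigidityGen
import Literature.Computability.AlgebraicComplexity.ArithCircuitProofs
import Literature.Computability.AlgebraicComplexity.PermanentIrreducible

/-!
# The spread engine (line `uncharged-face-walk` of crux `PerMultiplesHard`, route DivisionGap;
stubs `spreadPatterns`, `spreadPatternsCol`)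

Fix a ROW SHIFT `ζ : Equiv.Perm (Fin n)`.  An exponent table `m` (on the `n × n` variables) is a
`ζ`-SPREAD PROBE for the permutation `π` if every cell `(a, b)` of `m` has `π b = a ∨ π b = ζ a`: in each
row `a` only the two columns `π⁻¹ a`, `π⁻¹ (ζ a)` may be occupied (pure monomials are the case where the
shift is unused).  The spread engine (`spreadPatterns`): for `n ≥ 5` and a TORUS-HOMOGENEOUS
`g ∈ ℝ≥0[x_ij]` (all monomials have the same row margins `R` and column margins `C`) all of whose rows
are hit, the number of permutations `π` admitting a `ζ`-spread probe in `supp g` satisfies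
`# · 5^{⌊n/10⌋} ≤ L(g) · 4^{⌊n/10⌋} · n!` (`L = complexity` over `ℝ≥0`) — every permutation near which
`g` has a monomial with at most the two probe cells per row costs `(5/4)^{n/10}/n!` of a gate, whatever
the multiplicities.  It is the composition of the two landed stubs `stub_typedDecompositionFifth`
(typed decomposition with the `(n/5, 2n/5]` row-support window, p105314) and `stub_spreadRigidityGen`
(type rigidity of probes for an arbitrary shift, p106103) through the counting lemma
`spreadCount_le_of_decomposition`.  The transposed engine `spreadPatternsCol` (column probes:
`π a = b ∨ π a = ζ b`, all COLUMNS hit) follows by the symmetry `x_(a,b) ↦ x_(b,a)`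
(`rename Prod.swap`, a complexity-preserving injective renaming).

-- adapted from Cruxes/PerMultiplesHard/Lines/uncharged_face_walk.lean (section "The spread engine",
sorry-free there; the skeleton-local definitions `IsSpreadProbe`, `spreadCount`, `spreadCompatible`,
`colSpreadCount` are inlined here)

Not here: the `k`-cell engine (`zSpreadPatterns`, `zSpreadPatternsCol`) and the line's open core.
-/

noncomputable section

-- the namespace `Summit.ValiantsHypothesis.ValiantsHypothesis.…` is mandated by the crux (registered stub names)
set_option linter.dupNamespace false

namespace Summit.ValiantsHypothesis.ValiantsHypothesis.Theorems.DivisionGap.PerMultiplesHard.SpreadPatterns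

open MvPolynomial Literature.Computability.AlgebraicComplexity
open scoped NNReal BigOperators

/-- **Probes force compatibility.**  If a `ζ`-spread probe `m` of `a · b` for `π` exists and `a` is
torus-homogeneous with margins `(ρ, γ)`, then `π` is COMPATIBLE with the typed rectangle
`(S, T) = ({i | ρ i ≠ 0}, {j | γ j ≠ 0})`: every row of `S` sees `T` through one of its two probe columns
`π⁻¹ i`, `π⁻¹ (ζ i)`, and every column of `T` is a probe column of some row of `S` (the part `B ∈ supp a`
of the probe sits inside the probe, and its rows / columns are exactly the supports of the type).
[folklore] -/
theorem spreadCompatible_of_probe {n : ℕ} {ζ : Equiv.Perm (Fin n)} {a b : MvPolynomial (Fin n × Fin n) ℝ≥0}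
    {m : (Fin n × Fin n) →₀ ℕ} (hm : m ∈ (a * b).support) (π : Equiv.Perm (Fin n))
    (hπ : ∀ e ∈ m.support, π e.2 = e.1 ∨ π e.2 = ζ e.1) {ρ γ : Fin n → ℕ}
    (hty : ∀ B ∈ a.support, (∀ i, ∑ j, B (i, j) = ρ i) ∧ (∀ j, ∑ i, B (i, j) = γ j)) :
    (∀ i ∈ (Finset.univ.filter fun i => ρ i ≠ 0),
        π.symm i ∈ (Finset.univ.filter fun j => γ j ≠ 0) ∨
          π.symm (ζ i) ∈ (Finset.univ.filter fun j => γ j ≠ 0)) ∧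
      (∀ j ∈ (Finset.univ.filter fun j => γ j ≠ 0),
        π j ∈ (Finset.univ.filter fun i => ρ i ≠ 0) ∨
          ∃ i ∈ (Finset.univ.filter fun i => ρ i ≠ 0), ζ i = π j) := by
  classical
  obtain ⟨B, hB, B', -, hBB'⟩ := Finset.mem_add.mp (MvPolynomial.support_mul a b hm)
  have hle : ∀ e, B e ≤ m e := fun e => by rw [← hBB', Finsupp.add_apply]; exact Nat.le_add_right _ _
  obtain ⟨hρ, hγ⟩ := hty B hB
  have hcell : ∀ e, B e ≠ 0 → (π e.2 = e.1 ∨ π e.2 = ζ e.1) := fun e he =>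
    hπ e (Finsupp.mem_support_iff.mpr (fun h0 => he (Nat.eq_zero_of_le_zero (h0 ▸ hle e))))
  -- a nonzero cell `(i, j)` of `B` has `ρ i ≠ 0` and `γ j ≠ 0`
  have hρ_of : ∀ i j, B (i, j) ≠ 0 → ρ i ≠ 0 := by
    intro i j hij h0
    have h1 : B (i, j) ≤ ∑ j', B (i, j') :=
      Finset.single_le_sum (f := fun j' => B (i, j')) (fun _ _ => Nat.zero_le _) (Finset.mem_univ j)
    rw [hρ i, h0] at h1
    exact hij (Nat.eq_zero_of_le_zero h1)
  have hγ_of : ∀ i j, B (i, j) ≠ 0 → γ j ≠ 0 := by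
    intro i j hij h0
    have h1 : B (i, j) ≤ ∑ i', B (i', j) :=
      Finset.single_le_sum (f := fun i' => B (i', j)) (fun _ _ => Nat.zero_le _) (Finset.mem_univ i)
    rw [hγ j, h0] at h1
    exact hij (Nat.eq_zero_of_le_zero h1)
  refine ⟨?_, ?_⟩
  · intro i hi
    have hρi : ρ i ≠ 0 := (Finset.mem_filter.mp hi).2
    have hex : ∃ j, B (i, j) ≠ 0 := by
      by_contra hcon
      push Not at hcon
      exact hρi ((hρ i).symm.trans (Finset.sum_eq_zero fun j _ => hcon j))
    obtain ⟨j, hj⟩ := hex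
    have hjT : j ∈ Finset.univ.filter (fun j => γ j ≠ 0) :=
      Finset.mem_filter.mpr ⟨Finset.mem_univ _, hγ_of i j hj⟩
    rcases hcell (i, j) hj with h1 | h2
    · left
      have h1' : π j = i := h1
      have : π.symm i = j := by rw [← h1']; exact π.symm_apply_apply j
      rw [this]; exact hjT
    · right
      have h2' : π j = ζ i := h2
      have : π.symm (ζ i) = j := by rw [← h2']; exact π.symm_apply_apply j
      rw [this]; exact hjT
  · intro j hj
    have hγj : γ j ≠ 0 := (Finset.mem_filter.mp hj).2
    have hex : ∃ i, B (i, j) ≠ 0 := by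
      by_contra hcon
      push Not at hcon
      exact hγj ((hγ j).symm.trans (Finset.sum_eq_zero fun i _ => hcon i))
    obtain ⟨i, hi⟩ := hex
    have hiS : i ∈ Finset.univ.filter (fun i => ρ i ≠ 0) :=
      Finset.mem_filter.mpr ⟨Finset.mem_univ _, hρ_of i j hi⟩
    rcases hcell (i, j) hi with h1 | h2
    · left; rw [show π j = i from h1]; exact hiS
    · right; exact ⟨i, hiS, (show π j = ζ i from h2).symm⟩

/-- **The counting lemma of the spread engine.**  If `g = Σ_{t<s} a_t · b_t` and the permutations served
by each `a_t · b_t` (those with a `ζ`-spread probe in its support) number at most `K / 5^{⌊n/10⌋}`, then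
the permutations with a `ζ`-spread probe in `supp g` number at most `s · K / 5^{⌊n/10⌋}`.  Only
`supp (Σ) ⊆ ⋃ supp` is used. [folklore] -/
theorem spreadCount_le_of_decomposition {n s : ℕ} (ζ : Equiv.Perm (Fin n))
    (g : MvPolynomial (Fin n × Fin n) ℝ≥0) (a b : Fin s → MvPolynomial (Fin n × Fin n) ℝ≥0)
    (hg : g = ∑ t, a t * b t) (K : ℕ)
    (hK : ∀ t, ((Finset.univ : Finset (Equiv.Perm (Fin n))).filter fun π =>
        ∃ m ∈ (a t * b t).support, ∀ e ∈ m.support, π e.2 = e.1 ∨ π e.2 = ζ e.1).card *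
          5 ^ (n / 10) ≤ K) :
    ((Finset.univ : Finset (Equiv.Perm (Fin n))).filter fun π =>
        ∃ m ∈ g.support, ∀ e ∈ m.support, π e.2 = e.1 ∨ π e.2 = ζ e.1).card * 5 ^ (n / 10) ≤
      s * K := by
  classical
  have h1 : ((Finset.univ : Finset (Equiv.Perm (Fin n))).filter fun π =>
        ∃ m ∈ g.support, ∀ e ∈ m.support, π e.2 = e.1 ∨ π e.2 = ζ e.1) ⊆
      Finset.univ.biUnion fun t => (Finset.univ : Finset (Equiv.Perm (Fin n))).filter fun π =>
        ∃ m ∈ (a t * b t).support, ∀ e ∈ m.support, π e.2 = e.1 ∨ π e.2 = ζ e.1 := by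
    intro π hπ
    obtain ⟨-, m, hmg, hprobe⟩ := Finset.mem_filter.mp hπ
    rw [hg] at hmg
    obtain ⟨t, -, ht⟩ := Finset.mem_biUnion.mp (MvPolynomial.support_sum hmg)
    exact Finset.mem_biUnion.mpr ⟨t, Finset.mem_univ t,
      Finset.mem_filter.mpr ⟨Finset.mem_univ _, m, ht, hprobe⟩⟩
  calc ((Finset.univ : Finset (Equiv.Perm (Fin n))).filter fun π =>
          ∃ m ∈ g.support, ∀ e ∈ m.support, π e.2 = e.1 ∨ π e.2 = ζ e.1).card * 5 ^ (n / 10)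
      ≤ (Finset.univ.biUnion fun t => (Finset.univ : Finset (Equiv.Perm (Fin n))).filter fun π =>
          ∃ m ∈ (a t * b t).support, ∀ e ∈ m.support, π e.2 = e.1 ∨ π e.2 = ζ e.1).card *
            5 ^ (n / 10) :=
        Nat.mul_le_mul_right _ (Finset.card_le_card h1)
    _ ≤ (∑ t, ((Finset.univ : Finset (Equiv.Perm (Fin n))).filter fun π =>
          ∃ m ∈ (a t * b t).support, ∀ e ∈ m.support, π e.2 = e.1 ∨ π e.2 = ζ e.1).card) *
            5 ^ (n / 10) :=
        Nat.mul_le_mul_right _ Finset.card_biUnion_le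
    _ = ∑ t, ((Finset.univ : Finset (Equiv.Perm (Fin n))).filter fun π =>
          ∃ m ∈ (a t * b t).support, ∀ e ∈ m.support, π e.2 = e.1 ∨ π e.2 = ζ e.1).card *
            5 ^ (n / 10) := Finset.sum_mul _ _ _
    _ ≤ ∑ _t : Fin s, K := Finset.sum_le_sum fun t _ => hK t
    _ = s * K := by rw [Finset.sum_const, Finset.card_univ, Fintype.card_fin, smul_eq_mul]

/-- **The spread engine** (registered stub `spreadPatterns`; composition of
`stub_typedDecompositionFifth` and `stub_spreadRigidityGen`).  For `n ≥ 5`, a fixed row shift `ζ` and a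
torus-homogeneous `g` (margins `(R, C)`) all of whose rows are hit, the number of permutations `π` for
which `supp g` contains a `ζ`-spread probe (a monomial all of whose cells `(a, b)` satisfy
`π b = a ∨ π b = ζ a`), times `5^{⌊n/10⌋}`, is at most `L(g) · 4^{⌊n/10⌋} · n!`.  Proof: decompose
`g = Σ_{t<s} a_t b_t` with `s ≤ L(g)` and every `a_t` typed with row support in `(n/5, 2n/5]`
(`stub_typedDecompositionFifth`); a probe of `a_t b_t` for `π` makes `π` compatible with the type of `a_t`
(`spreadCompatible_of_probe`), and compatible permutations are few (`stub_spreadRigidityGen`); sum over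
`t` (`spreadCount_le_of_decomposition`).  Generalises the pure count (`thinPatterns`). [folklore] -/
theorem spreadPatterns :
    ∀ n ≥ 5, ∀ (ζ : Equiv.Perm (Fin n)) (g : MvPolynomial (Fin n × Fin n) ℝ≥0) (R C : Fin n → ℕ),
      (∀ m ∈ g.support, (∀ i, ∑ j, m (i, j) = R i) ∧ (∀ j, ∑ i, m (i, j) = C j)) →
      (∀ i, R i ≠ 0) →
      ((Finset.univ : Finset (Equiv.Perm (Fin n))).filter fun π =>
          ∃ m ∈ g.support, ∀ e ∈ m.support, π e.2 = e.1 ∨ π e.2 = ζ e.1).card * 5 ^ (n / 10) ≤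
        complexity g * (4 ^ (n / 10) * n.factorial) := by
  classical
  intro n hn ζ g R C hg hR
  obtain ⟨s, hs, a, b, hgab, htyp⟩ :=
    Summit.ValiantsHypothesis.ValiantsHypothesis.Theorems.DivisionGap.PerMultiplesHard.TypedDecompositionFifth.stub_typedDecompositionFifth
      n hn g R C hg hR
  have hK : ∀ t, ((Finset.univ : Finset (Equiv.Perm (Fin n))).filter fun π =>
      ∃ m ∈ (a t * b t).support, ∀ e ∈ m.support, π e.2 = e.1 ∨ π e.2 = ζ e.1).card * 5 ^ (n / 10) ≤
        4 ^ (n / 10) * n.factorial := by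
    intro t
    obtain ⟨ρ, γ, hty, hlo, hhi⟩ := htyp t
    set S : Finset (Fin n) := Finset.univ.filter fun i => ρ i ≠ 0 with hS
    set T : Finset (Fin n) := Finset.univ.filter fun j => γ j ≠ 0 with hT
    have hsub : ((Finset.univ : Finset (Equiv.Perm (Fin n))).filter fun π =>
        ∃ m ∈ (a t * b t).support, ∀ e ∈ m.support, π e.2 = e.1 ∨ π e.2 = ζ e.1) ⊆
      (Finset.univ : Finset (Equiv.Perm (Fin n))).filter fun π =>
        (∀ i ∈ S, π.symm i ∈ T ∨ π.symm (ζ i) ∈ T) ∧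
        (∀ j ∈ T, π j ∈ S ∨ ∃ i ∈ S, ζ i = π j) := by
      intro π hπ
      obtain ⟨-, m, hm, hprobe⟩ := Finset.mem_filter.mp hπ
      exact Finset.mem_filter.mpr ⟨Finset.mem_univ _, spreadCompatible_of_probe hm π hprobe hty⟩
    have hrig :=
      Summit.ValiantsHypothesis.ValiantsHypothesis.Theorems.DivisionGap.PerMultiplesHard.SpreadRigidityGen.stub_spreadRigidityGen
        n S.card ζ S T rfl hlo hhi
    calc ((Finset.univ : Finset (Equiv.Perm (Fin n))).filter fun π =>
            ∃ m ∈ (a t * b t).support, ∀ e ∈ m.support, π e.2 = e.1 ∨ π e.2 = ζ e.1).card *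
              5 ^ (n / 10)
        ≤ ((Finset.univ : Finset (Equiv.Perm (Fin n))).filter fun π =>
            (∀ i ∈ S, π.symm i ∈ T ∨ π.symm (ζ i) ∈ T) ∧
            (∀ j ∈ T, π j ∈ S ∨ ∃ i ∈ S, ζ i = π j)).card * 5 ^ (n / 10) :=
          Nat.mul_le_mul_right _ (Finset.card_le_card hsub)
      _ ≤ 4 ^ (n / 10) * n.factorial := hrig
  calc ((Finset.univ : Finset (Equiv.Perm (Fin n))).filter fun π =>
          ∃ m ∈ g.support, ∀ e ∈ m.support, π e.2 = e.1 ∨ π e.2 = ζ e.1).card * 5 ^ (n / 10)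
      ≤ s * (4 ^ (n / 10) * n.factorial) := spreadCount_le_of_decomposition ζ g a b hgab _ hK
    _ ≤ complexity g * (4 ^ (n / 10) * n.factorial) := Nat.mul_le_mul_right _ hs

/-- **The transposed spread engine** (registered stub `spreadPatternsCol`).  For `n ≥ 5`, every fixed shift
`ζ` and every torus-homogeneous `g` all of whose COLUMNS are hit, the number of permutations `π` for which
`supp g` contains a `ζ`-COLUMN probe (a monomial all of whose cells `(a, b)` satisfy `π a = b ∨ π a = ζ b`),
times `5^{⌊n/10⌋}`, is at most `L(g) · 4^{⌊n/10⌋} · n!`.  Proof: apply `spreadPatterns` to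
`rename Prod.swap g`, whose monomials are the transposes (margins exchanged), whose complexity is the same
(injective renaming, `complexity_rename_of_injective_holds`) and whose row probes are the column probes of
`g`. [folklore] -/
theorem spreadPatternsCol :
    ∀ n ≥ 5, ∀ (ζ : Equiv.Perm (Fin n)) (g : MvPolynomial (Fin n × Fin n) ℝ≥0) (R C : Fin n → ℕ),
      (∀ m ∈ g.support, (∀ i, ∑ j, m (i, j) = R i) ∧ (∀ j, ∑ i, m (i, j) = C j)) →
      (∀ j, C j ≠ 0) →
      ((Finset.univ : Finset (Equiv.Perm (Fin n))).filter fun π =>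
          ∃ m ∈ g.support, ∀ e ∈ m.support, π e.1 = e.2 ∨ π e.1 = ζ e.2).card * 5 ^ (n / 10) ≤
        complexity g * (4 ^ (n / 10) * n.factorial) := by
  classical
  intro n hn ζ g R C hg hC
  have hsw : Function.Injective (Prod.swap : Fin n × Fin n → Fin n × Fin n) := Prod.swap_injective
  set gT : MvPolynomial (Fin n × Fin n) ℝ≥0 := rename Prod.swap g with hgT
  have hsupp : gT.support = g.support.image (Finsupp.mapDomain Prod.swap) :=
    MvPolynomial.support_rename_of_injective hsw
  have happ : ∀ (m : (Fin n × Fin n) →₀ ℕ) (a b : Fin n),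
      Finsupp.mapDomain Prod.swap m (a, b) = m (b, a) := by
    intro m a b
    have : ((a, b) : Fin n × Fin n) = Prod.swap (b, a) := rfl
    rw [this, Finsupp.mapDomain_apply hsw]
  -- margins of the transpose
  have hgT' : ∀ m ∈ gT.support, (∀ i, ∑ j, m (i, j) = C i) ∧ (∀ j, ∑ i, m (i, j) = R j) := by
    intro m' hm'
    rw [hsupp, Finset.mem_image] at hm'
    obtain ⟨m, hm, rfl⟩ := hm'
    obtain ⟨hr, hc⟩ := hg m hm
    refine ⟨fun i => ?_, fun j => ?_⟩
    · rw [← hc i]; exact Finset.sum_congr rfl fun j _ => happ m i j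
    · rw [← hr j]; exact Finset.sum_congr rfl fun i _ => happ m i j
  have heng := spreadPatterns n hn ζ gT C R hgT' hC
  have hcx : complexity gT = complexity g := complexity_rename_of_injective_holds hsw g
  -- column probes of `g` are row probes of `gT`
  have hle : ((Finset.univ : Finset (Equiv.Perm (Fin n))).filter fun π =>
        ∃ m ∈ g.support, ∀ e ∈ m.support, π e.1 = e.2 ∨ π e.1 = ζ e.2).card ≤
      ((Finset.univ : Finset (Equiv.Perm (Fin n))).filter fun π =>
        ∃ m ∈ gT.support, ∀ e ∈ m.support, π e.2 = e.1 ∨ π e.2 = ζ e.1).card := by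
    refine Finset.card_le_card fun π hπ => ?_
    obtain ⟨-, M, hM, hprobe⟩ := Finset.mem_filter.mp hπ
    refine Finset.mem_filter.mpr ⟨Finset.mem_univ _, Finsupp.mapDomain Prod.swap M, ?_, ?_⟩
    · rw [hsupp]; exact Finset.mem_image_of_mem _ hM
    · intro e he
      rw [Finsupp.mapDomain_support_of_injective hsw, Finset.mem_image] at he
      obtain ⟨e₀, he₀, rfl⟩ := he
      simpa [Prod.fst_swap, Prod.snd_swap] using hprobe e₀ he₀
  calc ((Finset.univ : Finset (Equiv.Perm (Fin n))).filter fun π =>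
          ∃ m ∈ g.support, ∀ e ∈ m.support, π e.1 = e.2 ∨ π e.1 = ζ e.2).card * 5 ^ (n / 10)
      ≤ ((Finset.univ : Finset (Equiv.Perm (Fin n))).filter fun π =>
          ∃ m ∈ gT.support, ∀ e ∈ m.support, π e.2 = e.1 ∨ π e.2 = ζ e.1).card * 5 ^ (n / 10) :=
        Nat.mul_le_mul_right _ hle
    _ ≤ complexity gT * (4 ^ (n / 10) * n.factorial) := heng
    _ = complexity g * (4 ^ (n / 10) * n.factorial) := by rw [hcx]

end Summit.ValiantsHypothesis.ValiantsHypothesis.Theorems.DivisionGap.PerMultiplesHard.SpreadPatterns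

end
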